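import Mathlib
import HarnessLib
import Summits.ValiantsHypothesis.ValiantsHypothesis.Theses.MonotoneRestoration
import Literature.Computability.AlgebraicComplexity.ArithCircuit
import Literature.Computability.AlgebraicComplexity.ArithCircuitProofs
import Literature.Computability.AlgebraicComplexity.MonotoneStructure
import Literature.Computability.AlgebraicComplexity.PermanentIrreducible
import Literature.ModelTheory.FiniteModelTheory.CkEquiv
import Summits.ValiantsHypothesis.ValiantsHypothesis.Theorems.MonotoneRestorationMonotoneRestorationQPCosetCount
import Summits.ValiantsHypothesis.ValiantsHypothesis.Theorems.MonotoneRestorationMonotoneRestorationQPSymmetricLB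
import Summits.ValiantsHypothesis.ValiantsHypothesis.Theorems.MonotoneRestorationMonotoneRestorationQPSupportSymmetrisation
import Summits.ValiantsHypothesis.ValiantsHypothesis.Theorems.MonotoneRestorationMonotoneRestorationQPSparseRegime
import Summits.ValiantsHypothesis.ValiantsHypothesis.Theorems.MonotoneRestorationMonotoneRestorationQPBeta
import Literature.Computability.AlgebraicComplexity.SymmetricArithCircuit
import Literature.Computability.AlgebraicComplexity.DawarWilsenach2025Proofs
import Literature.GroupTheory.PermutationGroups.SmallIndexSubgroups
import Summits.ValiantsHypothesis.ValiantsHypothesis.Theorems.MonotoneRestorationQP.Negative.LoadBearing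
import Summits.ValiantsHypothesis.ValiantsHypothesis.Theorems.MonotoneRestorationMonotoneRestorationQPPermSupportCount

/-! TTRL-lite variant V20152 of stmt-ValiantsHypothesis-15886 -/

-- `Summit.ValiantsHypothesis.ValiantsHypothesis.…` is the tree's mandated single-conjunct layout
-- (Sub = Summit), so the duplicated namespace component is intended.
set_option linter.dupNamespace false

namespace Summit.ValiantsHypothesis.ValiantsHypothesis.Theorems

open Summit.ValiantsHypothesis.ValiantsHypothesis.Theses.MonotoneRestoration
open Literature.Computability.AlgebraicComplexity

/-- TTRL-lite variant V20152 (`lemma_proposal`) of `stub_monotoneSupportReduction`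
(`stmt-ValiantsHypothesis-15886`): if every gate value `(gateValues P.gates).getD i 0` of a
circuit `P` over `Fin n × Fin n` is invariant under the diagonal action `x_{pq} ↦ x_{σ p, σ q}` of
each permutation `σ` fixing its support set `K i` pointwise, and the output of `P` is a gate
`j < P.size` with empty support `K j = ∅`, then `P.eval` is DIAGONALLY invariant under every
permutation `σ` (the hypothesis at `j` is unconditional since `K j = ∅`, and `P.eval` unfolds to
the value of gate `j`). This is why only diagonal — not two-sided `(σ, τ)` — matrix symmetry can
be read off the output clause of a supported program. [folklore] -/
theorem stub_monotoneSupportReduction_var20152 :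
    ∀ (n : ℕ) (P : ArithCircuit ℂ (Fin n × Fin n)) (K : ℕ → Finset (Fin n)),
      (∀ (i : ℕ) (σ : Equiv.Perm (Fin n)), i < P.size → (∀ x ∈ K i, σ x = x) →
        MvPolynomial.rename (fun pq : Fin n × Fin n => (σ pq.1, σ pq.2))
          ((ArithCircuit.gateValues P.gates).getD i 0) =
          (ArithCircuit.gateValues P.gates).getD i 0) →
      (∃ j, P.output = .gate j ∧ j < P.size ∧ K j = ∅) →
      ∀ σ : Equiv.Perm (Fin n),
        MvPolynomial.rename (fun pq : Fin n × Fin n => (σ pq.1, σ pq.2)) P.eval = P.eval := by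
  intro n P K hinv hout σ
  obtain ⟨j, hj, hlt, hK⟩ := hout
  have h := hinv j σ hlt (by simp [hK])
  simpa [ArithCircuit.eval, hj, ArithCircuit.Operand.eval] using h

end Summit.ValiantsHypothesis.ValiantsHypothesis.Theorems
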